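import Summits.SmoothPoincare4.SmoothPoincare4.Theorems.ConvexBisectionAcyclicBisectionExistsStabilisationData
import HarnessLib

/-!
# N3 (`stub_STgeo`) ▸ N3-nat ▸ piece N3d-0 `node_normalisedDatum`: THE CONTRACT — the piece from its three
# sub-pieces GAUGE (G), RE-SPACE (R), SQUEEZE (S), kernel-checked
(wave 8, brick J7-2 of stub `stub_STgeo` = node N3 of NF4, line `modp-braid-orbits`, crux
`ConvexBisection.AcyclicBisectionExists`, item stmt-SmoothPoincare4-10508; registered sub-goal
`helper_exists_cores_norm_lt`; design file `work/design/N3d_Pieces_Design.lean` (J7, wave 8) §A; the piece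
text is the hypothesis `h0` of `StabilisationData.node_STnat_of_pieces` (`…StabilisationAngles.lean`, H6).)

The piece N3d-0 (`ModelsOnFibred M g l → NormalisedDatum M g l S`: old handles re-spaced to the
directions `pageDir (n+4) (k+4)`, ranges off the block sector and inside `‖cx‖² < 4 − ε₁`, seam map the
identity on the binding tube) is GAUGE ∘ SQUEEZE ∘ RE-SPACE ∘ GAUGE, in this order (design finding
F-J7-2: G4's sector rotations are exactly fibred only away from the binding, so the gauge must be fixed
near the binding BEFORE re-spacing; the re-spacing may let the ranges drift out to `‖cx‖² < 4`, so the
squeeze comes after it and the second gauge after the squeeze).  The three sub-pieces enter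
`node_normalisedDatum_of_subpieces` as hypotheses, as their closed ∀-texts ON DATA `(X, h, D, bX, Ψ)`
(`work/stubs/sig_piece0_gauge.txt`, `sig_piece0_rotate.txt`, `sig_piece0_squeeze.txt`); the contract is
proved.  `exists_cores_norm_lt` (the attaching circles lie in `‖cx‖² < r₁` for some `5/2 ≤ r₁ < 4`) feeds
the first gauge.  No definitions.
References: J. B. Etnyre, T. Fuller, IMRN 2006, §2 [EtnyreFuller2006].
-/

noncomputable section

-- the prescribed namespace `Summit.<P>.<Sub>.…` duplicates `SmoothPoincare4` (P = Sub)
set_option linter.dupNamespace false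

open scoped Manifold ContDiff Topology Real
open Set Function

namespace Summit.SmoothPoincare4.SmoothPoincare4.Theorems.AcyclicBisectionExists.ModpBraidOrbits

open Literature.GroupTheory.CombinatorialGroupTheory.SignedHurwitz
open Literature.Topology.FourManifolds Literature.Topology.FourManifolds.LefschetzBase
open Literature.Topology.FourManifolds.HandleAttachingMap
open Literature.Geometry.Symplectic

namespace StabNormaliseContract

/-! ## §1 The cores of a family of page curves stay away from the rim -/

/-- The attaching circles of finitely many 2-handle maps whose circles lie in flat pages lie in
`{‖cx‖² < r₁}` for some `5/2 ≤ r₁ < 4` (compactness of the circle; pages have `‖cx‖² < 4`). [folklore] -/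
theorem exists_cores_norm_lt {g n : ℕ} (h : Fin n → HandleAttachingMap 3 2 (Base g)) (d : Fin n → ℂ)
    (hpage : ∀ i θ, (h i).attachingCircle θ ∈ page g (d i)) :
    ∃ r₁ : ℝ, 5 / 2 ≤ r₁ ∧ r₁ < 4 ∧ ∀ i θ, ‖cx ((h i).attachingCircle θ).1‖ ^ 2 < r₁ := by
  -- each circle: a continuous function on a compact sphere, pointwise `< 4`, has a maximum `< 4`
  have hone : ∀ i, ∃ m : ℝ, m < 4 ∧ ∀ θ, ‖cx ((h i).attachingCircle θ).1‖ ^ 2 ≤ m := by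
    intro i
    have hc : Continuous fun θ => ‖cx ((h i).attachingCircle θ).1‖ ^ 2 :=
      ((contDiff_cx.continuous.comp (continuous_subtype_val.comp
        (h i).continuous_attachingCircle)).norm).pow 2
    haveI : Nonempty (Metric.sphere (0 : EuclideanSpace ℝ (Fin 2)) 1) := ⟨circlePt 0⟩
    obtain ⟨θ₀, -, hθ₀⟩ := isCompact_univ.exists_isMaxOn univ_nonempty hc.continuousOn
    exact ⟨_, (hpage i θ₀).1, fun θ => hθ₀ (mem_univ θ)⟩
  choose m hm4 hm using hone
  rcases isEmpty_or_nonempty (Fin n) with hn | hn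
  · exact ⟨5 / 2, le_rfl, by norm_num, fun i => (IsEmpty.false i).elim⟩
  · obtain ⟨i₀, hi₀⟩ := Finite.exists_max m
    refine ⟨max (5 / 2) ((m i₀ + 4) / 2), le_max_left _ _, max_lt (by norm_num) (by linarith [hm4 i₀]),
      fun i θ => lt_of_le_of_lt ((hm i θ).trans (hi₀ i)) ?_⟩
    exact lt_of_lt_of_le (by linarith [hm4 i₀]) (le_max_right _ _)

/-! ## §2 The contract -/

/-- **CONTRACT N3d-0: `node_normalisedDatum` (text of `work/stubs/sig_node_normalisedDatum.txt`) from
(G), (R), (S)** — PROVED: unpack the fibred model; gauge near the binding ((G) with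
`r₂ = (r₁ + 4)/2 < 4`, `r₁` from `exists_cores_norm_lt`); re-space ((R)); squeeze ((S)); gauge again
((G) with `r₁ = 3`, `r₂ = 16/5`); repackage (`4 − S.ε₁ ≥ 7/2 > 16/5 > 3` by `S.hε₁`).
[cite: EtnyreFuller2006, §2] -/
theorem node_normalisedDatum_of_subpieces
    (hG : ∀ (M : Type) [TopologicalSpace M] [T2Space M] [SecondCountableTopology M]
      [ChartedSpace (EuclideanSpace ℝ (Fin 4)) M] [IsManifold (𝓡 4) ∞ M] (g : ℕ) (ι : Type) [Finite ι]
      (X : Type) [TopologicalSpace X] [T2Space X] [SecondCountableTopology X] [CompactSpace X]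
      [ChartedSpace (EuclideanHalfSpace 4) X] [IsManifold (𝓡∂ 4) ∞ X]
      (h : ι → HandleAttachingMap 3 2 (Base g)) (D : MultiAttachmentData h (𝓡∂ 4) X)
      (bX : BoundaryData (𝓡∂ 4) X (𝓡 3)) (Ψ : bX.carrier ≃ₘ⟮𝓡 3, 𝓡 3⟯ (bBase g).carrier)
      (r₁ r₂ : ℝ), 5 / 2 ≤ r₁ → r₁ < r₂ → r₂ < 4 →
      (∀ i θ, ‖cx ((h i).attachingCircle θ).1‖ ^ 2 < r₁) →
      IsBoundaryGluing bX (bBase g) Ψ (𝓡 4) M →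
      (∀ (y : bX.carrier) (a : ↥(coresComplement h)), bX.incl y = D.jA a →
        ∃ r : ℝ, 0 < r ∧ w g ((bBase g).incl (Ψ y)).1 = (r : ℂ) * w g (a : Base g).1) →
      ∃ Ψ' : bX.carrier ≃ₘ⟮𝓡 3, 𝓡 3⟯ (bBase g).carrier,
        IsBoundaryGluing bX (bBase g) Ψ' (𝓡 4) M ∧
        (∀ (y : bX.carrier) (a : ↥(coresComplement h)), bX.incl y = D.jA a →
          ∃ r : ℝ, 0 < r ∧ w g ((bBase g).incl (Ψ' y)).1 = (r : ℂ) * w g (a : Base g).1) ∧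
        (∀ (y : bX.carrier) (a : ↥(coresComplement h)), bX.incl y = D.jA a →
          r₂ < ‖cx (a : Base g).1‖ ^ 2 → (bBase g).incl (Ψ' y) = (a : Base g)))
    (hR : ∀ (M : Type) [TopologicalSpace M] [T2Space M] [SecondCountableTopology M]
      [ChartedSpace (EuclideanSpace ℝ (Fin 4)) M] [IsManifold (𝓡 4) ∞ M] (g : ℕ) (l : IntWord g)
      (X : Type) [TopologicalSpace X] [T2Space X] [SecondCountableTopology X] [CompactSpace X]
      [ChartedSpace (EuclideanHalfSpace 4) X] [IsManifold (𝓡∂ 4) ∞ X]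
      (h : Fin l.length → HandleAttachingMap 3 2 (Base g)) (D : MultiAttachmentData h (𝓡∂ 4) X)
      (bX : BoundaryData (𝓡∂ 4) X (𝓡 3)) (Ψ : bX.carrier ≃ₘ⟮𝓡 3, 𝓡 3⟯ (bBase g).carrier),
      IsLefschetzLink g l h → IsBoundaryGluing bX (bBase g) Ψ (𝓡 4) M →
      (∀ (y : bX.carrier) (a : ↥(coresComplement h)), bX.incl y = D.jA a →
        ∃ r : ℝ, 0 < r ∧ w g ((bBase g).incl (Ψ y)).1 = (r : ℂ) * w g (a : Base g).1) →
      (∀ (y : bX.carrier) (a : ↥(coresComplement h)), bX.incl y = D.jA a →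
        4 < ‖cx (a : Base g).1‖ ^ 2 → (bBase g).incl (Ψ y) = (a : Base g)) →
      ∃ (h' : Fin l.length → HandleAttachingMap 3 2 (Base g)) (D' : MultiAttachmentData h' (𝓡∂ 4) X)
        (Ψ' : bX.carrier ≃ₘ⟮𝓡 3, 𝓡 3⟯ (bBase g).carrier),
        (∀ (i : Fin l.length) θ, (h' i).attachingCircle θ ∈ page g (pageDir (l.length + 4) (i + 4))) ∧
        (∀ i, shadow g (h' i).attachingCircle (h' i).continuous_attachingCircle = (l.get i).1) ∧
        (∀ i, pageTwisting g (h' i).attachingCircle (h' i).attachingFraming =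
          if (l.get i).2 then -1 else 1) ∧
        IsBoundaryGluing bX (bBase g) Ψ' (𝓡 4) M ∧
        (∀ (y : bX.carrier) (a : ↥(coresComplement h')), bX.incl y = D'.jA a →
          ∃ r : ℝ, 0 < r ∧ w g ((bBase g).incl (Ψ' y)).1 = (r : ℂ) * w g (a : Base g).1))
    (hS : ∀ (g : ℕ) (l : IntWord g)
      (X : Type) [TopologicalSpace X] [T2Space X] [SecondCountableTopology X] [CompactSpace X]
      [ChartedSpace (EuclideanHalfSpace 4) X] [IsManifold (𝓡∂ 4) ∞ X]
      (h : Fin l.length → HandleAttachingMap 3 2 (Base g)) (D : MultiAttachmentData h (𝓡∂ 4) X)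
      (bX : BoundaryData (𝓡∂ 4) X (𝓡 3)) (Ψ : bX.carrier ≃ₘ⟮𝓡 3, 𝓡 3⟯ (bBase g).carrier),
      (∀ (i : Fin l.length) θ, (h i).attachingCircle θ ∈ page g (pageDir (l.length + 4) (i + 4))) →
      (∀ i, shadow g (h i).attachingCircle (h i).continuous_attachingCircle = (l.get i).1) →
      (∀ i, pageTwisting g (h i).attachingCircle (h i).attachingFraming = if (l.get i).2 then -1 else 1) →
      (∀ (y : bX.carrier) (a : ↥(coresComplement h)), bX.incl y = D.jA a →
        ∃ r : ℝ, 0 < r ∧ w g ((bBase g).incl (Ψ y)).1 = (r : ℂ) * w g (a : Base g).1) →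
      ∃ (h' : Fin l.length → HandleAttachingMap 3 2 (Base g)) (D' : MultiAttachmentData h' (𝓡∂ 4) X),
        (∀ (i : Fin l.length) θ, (h' i).attachingCircle θ ∈ page g (pageDir (l.length + 4) (i + 4))) ∧
        (∀ i, shadow g (h' i).attachingCircle (h' i).continuous_attachingCircle = (l.get i).1) ∧
        (∀ i, pageTwisting g (h' i).attachingCircle (h' i).attachingFraming =
          if (l.get i).2 then -1 else 1) ∧
        (∀ i y, w g ((h' i).toFun y).1 ∉ blockSector l.length ∧ ‖cx ((h' i).toFun y).1‖ ^ 2 < 3) ∧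
        (∀ (y : bX.carrier) (a : ↥(coresComplement h')), bX.incl y = D'.jA a →
          ∃ r : ℝ, 0 < r ∧ w g ((bBase g).incl (Ψ y)).1 = (r : ℂ) * w g (a : Base g).1)) :
    ∀ (M : Type) [TopologicalSpace M] [T2Space M] [SecondCountableTopology M]
      [ChartedSpace (EuclideanSpace ℝ (Fin 4)) M] [IsManifold (𝓡 4) ∞ M] (g : ℕ) (l : IntWord g)
      (c : Fin g ⊕ Fin g → ℤ) (S : StabBaseData g l.length c),
      ModelsOnFibred M g l → NormalisedDatum M g l S := by
  intro M _ _ _ _ _ g l c S hM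
  obtain ⟨X, _, _, _, _, _, _, h, D, bX, Ψ, hlink, hglue, hseam⟩ := hM
  -- (G) near the binding: the cores lie in flat pages
  obtain ⟨r₁, hr₁, hr₁4, hcores⟩ := exists_cores_norm_lt h (fun i => pageDir l.length i) hlink.mem_page
  obtain ⟨Ψ₁, hglue₁, hseam₁, hgauge₁⟩ := hG M g (Fin l.length) X h D bX Ψ r₁ ((r₁ + 4) / 2) hr₁
    (by linarith) (by linarith) hcores hglue hseam
  have hgauge₁' : ∀ (y : bX.carrier) (a : ↥(coresComplement h)), bX.incl y = D.jA a →
      4 < ‖cx (a : Base g).1‖ ^ 2 → (bBase g).incl (Ψ₁ y) = (a : Base g) :=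
    fun y a hy h4 => hgauge₁ y a hy (by linarith)
  -- (R) re-space, (S) squeeze
  obtain ⟨h₂, D₂, Ψ₂, hpage₂, hsh₂, htw₂, hglue₂, hseam₂⟩ := hR M g l X h D bX Ψ₁ hlink hglue₁ hseam₁ hgauge₁'
  obtain ⟨h₃, D₃, hpage₃, hsh₃, htw₃, hrng₃, hseam₃⟩ := hS g l X h₂ D₂ bX Ψ₂ hpage₂ hsh₂ htw₂ hseam₂
  -- (G) again, down to `16/5`
  have hcores₃ : ∀ i θ, ‖cx ((h₃ i).attachingCircle θ).1‖ ^ 2 < 3 := fun i θ => (hrng₃ i (coreTubePt θ)).2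
  obtain ⟨Ψ₄, hglue₄, hseam₄, hgauge₄⟩ := hG M g (Fin l.length) X h₃ D₃ bX Ψ₂ 3 (16 / 5) (by norm_num)
    (by norm_num) (by norm_num) hcores₃ hglue₂ hseam₃
  have hε := S.hε₁
  refine ⟨X, inferInstance, inferInstance, inferInstance, inferInstance, inferInstance, inferInstance,
    h₃, D₃, bX, Ψ₄, hpage₃, hsh₃, htw₃, fun i y => ⟨(hrng₃ i y).1, ?_⟩, hglue₄, hseam₄,
    fun y a hy ha => hgauge₄ y a hy ?_⟩
  · linarith [(hrng₃ i y).2, hε.2]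
  · linarith [hε.2]

end StabNormaliseContract

/-! ## Registered helper -/

/-- **Registered helper `helper_exists_cores_norm_lt` (sub-goal of `stub_STgeo` ▸ N3-nat ▸ N3d-0, wave 8,
lead c5): the attaching circles of a finite family of 2-handle maps lying in flat pages stay inside
`‖cx‖² < r₁` for some `5/2 ≤ r₁ < 4`.** [folklore] -/
theorem helper_exists_cores_norm_lt : ∀ (g n : ℕ) (h : Fin n → Literature.Topology.FourManifolds.HandleAttachingMap 3 2 (Literature.Topology.FourManifolds.LefschetzBase.Base g)) (d : Fin n → ℂ), (∀ i θ, (h i).attachingCircle θ ∈ Literature.Topology.FourManifolds.LefschetzBase.page g (d i)) → ∃ r₁ : ℝ, 5 / 2 ≤ r₁ ∧ r₁ < 4 ∧ ∀ i θ, ‖Literature.Topology.FourManifolds.LefschetzBase.cx ((h i).attachingCircle θ).1‖ ^ 2 < r₁ :=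
  fun _ _ h d hd => StabNormaliseContract.exists_cores_norm_lt h d hd

end Summit.SmoothPoincare4.SmoothPoincare4.Theorems.AcyclicBisectionExists.ModpBraidOrbits

end
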